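import Literature.LinearAlgebra.QuadraticForm.TransverseLagrangian
import Literature.RepresentationTheory.HeisenbergGroup.HeisenbergGroup
import Literature.GroupTheory.GroupChunkExtension
import Mathlib.LinearAlgebra.Dual.Lemmas
import Mathlib.LinearAlgebra.Dimension.Free
import Mathlib.LinearAlgebra.FiniteDimensional.Lemmas
import Mathlib.LinearAlgebra.Projection
import HarnessLib

/-!
# `Sp(X)` acts transitively on Lagrangians; the big cell relative to a Lagrangian is generic

Topic `LinearAlgebra/QuadraticForm`; namespace `Literature.LinearAlgebra.QuadraticForm` (next to
`TransverseLagrangian.lean`, which it consumes). KERNEL mathematics only (definitions with bodies + theorems; no named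
fact, no `axiom`, no `sorry`).

Setting: `B` alternating (`LinearMap.IsAlt`) and nondegenerate on a finite-dimensional `V` over a field `K`;
"Lagrangian" = `B.orthogonal ℓ = ℓ`, "transversal" = `IsCompl`; `Sp(X)` = the tree's subgroup
`Heisenberg.PseudoSymplectic.isometries B ≤ GL(V)`.

[Rangarao1993, §2.1, Lemma 2.1] ("for proof see Bourbaki"): "(iii) If `L₁, L₂` are two transversal Lagrangian
subspaces, and `v₁, …, vₙ` is a basis of `L₁`, there exists a basis `v_{n+1}, …, v_{2n}` of `L₂` such that
`v₁, …, v_{2n}` is a symplectic basis of `X`. (iv) Let `X` and `Y` be symplectic vector spaces and `L₁, L₂`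
(`M₁, M₂`) be Lagrangian subspaces of `X` (of `Y`). If `dim X = dim Y`, and `σ` is an arbitrary `k`-linear map of `L₁`
onto `M₁` then `σ` can be extended as a symplectomorphism of `X` onto `Y`, mapping `Lᵢ` on `Mᵢ`, `i = 1, 2`."
[Rangarao1993, §2.2, p. 338]: "Let `Λ(X)` denote the set of all Lagrangian subspaces of `X`. It is clear that `Sp(X)`
acts transitively on `Λ(X)`. For `L ∈ Λ(X)`, let `P_L` denote the isotropy subgroup at `L`."

* §1 the basis-free content of (iii): for transversal isotropic `ℓ, m` with `V = ℓ ⊕ m` the pairing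
  `y ↦ B(·, y)|_ℓ` is an isomorphism `m ≃ ℓ^*` (`pairingDualEquiv`);
* §2 Lemma 2.1 (iv) for `X = Y = V`: a linear isomorphism `a : ℓ ≃ ℓ'` between members of two transversal
  Lagrangian pairs `(ℓ, m)`, `(ℓ', m')` extends to an isometry `g` of `B` with `g|_ℓ = a`, `g m = m'`
  (`extendSp`, `extendSp_mem_isometries`, `map_extendSp_left/right`) — `g = a ⊕ (a*)⁻¹` through §1;
* §3 **transitivity** ("`Sp(X)` acts transitively on `Λ(X)`"): `exists_isometry_map_eq` (any field, via
  [Duistermaat2011, Thm. 3.4.2] = `exists_orthogonal_eq_self_isCompl` for the complements);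
* §4 the **big cell** `Ω_ℓ = {g ∈ Sp(B) | gℓ ⋔ ℓ}` (= `P_L τ P_L`, the open `P_L`-double coset; [Weil1964, n° 32]:
  `Ω(X)`, "`γ(s)` est un isomorphisme") as a subset of `Sp(B)`: `Ω⁻¹ = Ω`, stability under the stabiliser `P_ℓ` on
  both sides, and — over an INFINITE field — **left-genericity** in the sense of `Literature.GroupTheory.IsLeftGeneric`
  ([Weil1964, n° 42]: the hypothesis of Lemme 6 holds for `U = Ω(X)`): every finite `T ⊆ Sp(B)` has a left translate
  inside `Ω_ℓ` (`isLeftGeneric_bigCell`; proof: a Lagrangian `m` transversal to all `tℓ`, `t ∈ T`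
  [LionVergne1980, §1.5.8] = `exists_orthogonal_eq_self_isCompl_forall`, and `x ∈ Sp` with `x m = ℓ` by §3).

## References

* [Rangarao1993] R. Ranga Rao, *On some explicit formulas in the theory of Weil representation*, Pacific J. Math.
  157 (1993) 335–371, §2.1 Lemma 2.1 (iii)–(iv), §2.2 (p. 338).
* [Weil1964] A. Weil, *Sur certains groupes d'opérateurs unitaires*, Acta Math. 111 (1964), n° 32 (`Ω(X)`), n° 42
  (Lemme 6 applies to `U = Ω(X)`).
* [Duistermaat2011] J. J. Duistermaat, *Fourier Integral Operators*, §3.4 Thm. 3.4.2.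
* [LionVergne1980] G. Lion, M. Vergne, *The Weil representation, Maslov index and Theta series*, §1.5.8 (proof).
-/

set_option autoImplicit false

namespace Literature.LinearAlgebra.QuadraticForm

universe u v

open Module
open Literature.RepresentationTheory.HeisenbergGroup
open Literature.GroupTheory (IsLeftGeneric)

variable {K : Type u} [Field K]
variable {V : Type v} [AddCommGroup V] [Module K V]

/-! ## §1 The pairing `m ≃ ℓ^*` of a transversal isotropic pair -/

section Pairing

variable (B : LinearMap.BilinForm K V) (ℓ m : Submodule K V)

/-- the pairing map `y ↦ (x ↦ B x y)`, `m → ℓ^*`. [cite: Rangarao1993, §2.1 Lemma 2.1 (iii)] -/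
def pairingDual : m →ₗ[K] Module.Dual K ℓ :=
  (B.domRestrict₁₂ ℓ m).flip

/-- formula. [cite: Rangarao1993, §2.1 Lemma 2.1 (iii)] -/
@[simp] theorem pairingDual_apply (y : m) (x : ℓ) : pairingDual B ℓ m y x = B x y := rfl

variable {B ℓ m}

/-- for `m` isotropic with `ℓ + m = V` and `B` nondegenerate, `y ↦ B(·, y)|_ℓ` is injective on `m`.
[cite: Rangarao1993, §2.1 Lemma 2.1 (iii)] -/
theorem pairingDual_injective (hN : B.Nondegenerate) (hm : ∀ x ∈ m, ∀ y ∈ m, B x y = 0) (hsup : ℓ ⊔ m = ⊤) :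
    Function.Injective (pairingDual B ℓ m) := by
  rw [injective_iff_map_eq_zero]
  intro y hy
  have h0 : ∀ v : V, B v y = 0 := by
    intro v
    have hv : v ∈ ℓ ⊔ m := by rw [hsup]; exact Submodule.mem_top
    obtain ⟨x, hx, z, hz, rfl⟩ := Submodule.mem_sup.1 hv
    have h1 : B x y = 0 := by
      have := congrArg (fun φ : Module.Dual K ℓ => φ ⟨x, hx⟩) hy
      simpa using this
    rw [map_add, LinearMap.add_apply, h1, hm z hz y y.2, add_zero]
  exact Subtype.ext (hN.2 y h0)

/-- **`m ≃ ℓ^*` for a transversal pair of Lagrangians** (the basis-free form of "there exists a basis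
`v_{n+1}, …, v_{2n}` of `L₂` such that `v₁, …, v_{2n}` is a symplectic basis": the dual basis): `B` nondegenerate,
`m` isotropic, `V = ℓ ⊕ m`, `dim ℓ = dim m`. [cite: Rangarao1993, §2.1 Lemma 2.1 (iii)] -/
theorem pairingDual_bijective [FiniteDimensional K V] (hN : B.Nondegenerate) (hm : ∀ x ∈ m, ∀ y ∈ m, B x y = 0)
    (h : IsCompl ℓ m) (hdim : finrank K ℓ = finrank K m) : Function.Bijective (pairingDual B ℓ m) := by
  have hinj := pairingDual_injective hN hm h.sup_eq_top
  refine ⟨hinj, ?_⟩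
  have hd : finrank K m = finrank K (Module.Dual K ℓ) := by rw [Subspace.dual_finrank_eq, hdim]
  exact (LinearMap.injective_iff_surjective_of_finrank_eq_finrank hd).1 hinj

/-- the isomorphism `m ≃ ℓ^*` of a transversal isotropic pair with `dim ℓ = dim m`.
[cite: Rangarao1993, §2.1 Lemma 2.1 (iii)] -/
noncomputable def pairingDualEquiv [FiniteDimensional K V] (hN : B.Nondegenerate)
    (hm : ∀ x ∈ m, ∀ y ∈ m, B x y = 0) (h : IsCompl ℓ m) (hdim : finrank K ℓ = finrank K m) :
    m ≃ₗ[K] Module.Dual K ℓ :=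
  LinearEquiv.ofBijective (pairingDual B ℓ m) (pairingDual_bijective hN hm h hdim)

/-- formula. [cite: Rangarao1993, §2.1 Lemma 2.1 (iii)] -/
@[simp] theorem pairingDualEquiv_apply [FiniteDimensional K V] (hN : B.Nondegenerate)
    (hm : ∀ x ∈ m, ∀ y ∈ m, B x y = 0) (h : IsCompl ℓ m) (hdim : finrank K ℓ = finrank K m) (y : m) (x : ℓ) :
    pairingDualEquiv hN hm h hdim y x = B x y := rfl

end Pairing

/-! ## §2 Extension of `a : ℓ ≃ ℓ'` to an isometry (Lemma 2.1 (iv)) -/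

section Extend

variable [FiniteDimensional K V] {B : LinearMap.BilinForm K V}
variable {ℓ m ℓ' m' : Submodule K V}

/-- Lagrangians have equal dimension (`2 dim ℓ = dim V`). [cite: Rangarao1993, §2.1 Lemma 2.1 (ii)] -/
theorem finrank_eq_of_orthogonal_eq_self (hN : B.Nondegenerate) (hℓ : B.orthogonal ℓ = ℓ)
    (hℓ' : B.orthogonal ℓ' = ℓ') : finrank K ℓ = finrank K ℓ' := by
  have h₁ := two_mul_finrank_eq_of_orthogonal_eq_self hN hℓ
  have h₂ := two_mul_finrank_eq_of_orthogonal_eq_self hN hℓ'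
  omega

/-- two transversal Lagrangians have equal dimension. [cite: Rangarao1993, §2.1 Lemma 2.1 (ii)–(iii)] -/
theorem finrank_eq_of_isCompl_of_orthogonal_eq_self (hN : B.Nondegenerate) (hℓ : B.orthogonal ℓ = ℓ)
    (hm : B.orthogonal m = m) : finrank K ℓ = finrank K m :=
  finrank_eq_of_orthogonal_eq_self hN hℓ hm

/-- the companion `d = (a*)⁻¹ : m ≃ m'` of `a : ℓ ≃ ℓ'`, through `m ≃ ℓ^*`, `m' ≃ ℓ'^*`: characterised by
`B (x', d y) = B (a⁻¹ x', y)`. [cite: Rangarao1993, §2.1 Lemma 2.1 (iv)] -/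
noncomputable def extendDual (hN : B.Nondegenerate) (hm : B.orthogonal m = m) (hℓ : B.orthogonal ℓ = ℓ)
    (h : IsCompl ℓ m) (hm' : B.orthogonal m' = m') (hℓ' : B.orthogonal ℓ' = ℓ') (h' : IsCompl ℓ' m')
    (a : ℓ ≃ₗ[K] ℓ') : m ≃ₗ[K] m' :=
  (pairingDualEquiv hN (isotropic_of_orthogonal_eq_self hm) h
      (finrank_eq_of_isCompl_of_orthogonal_eq_self hN hℓ hm)).trans
    (a.symm.dualMap.trans
      (pairingDualEquiv hN (isotropic_of_orthogonal_eq_self hm') h'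
        (finrank_eq_of_isCompl_of_orthogonal_eq_self hN hℓ' hm')).symm)

/-- the defining identity `B (x', d y) = B (a⁻¹ x', y)` (`x' ∈ ℓ'`, `y ∈ m`). [cite: Rangarao1993, §2.1 Lemma 2.1 (iv)] -/
theorem apply_extendDual (hN : B.Nondegenerate) (hm : B.orthogonal m = m) (hℓ : B.orthogonal ℓ = ℓ)
    (h : IsCompl ℓ m) (hm' : B.orthogonal m' = m') (hℓ' : B.orthogonal ℓ' = ℓ') (h' : IsCompl ℓ' m')
    (a : ℓ ≃ₗ[K] ℓ') (x' : ℓ') (y : m) :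
    B x' (extendDual hN hm hℓ h hm' hℓ' h' a y) = B (a.symm x' : ℓ) y := by
  have key : pairingDualEquiv hN (isotropic_of_orthogonal_eq_self hm') h'
        (finrank_eq_of_isCompl_of_orthogonal_eq_self hN hℓ' hm') (extendDual hN hm hℓ h hm' hℓ' h' a y) =
      a.symm.dualMap (pairingDualEquiv hN (isotropic_of_orthogonal_eq_self hm) h
        (finrank_eq_of_isCompl_of_orthogonal_eq_self hN hℓ hm) y) := by
    rw [extendDual, LinearEquiv.trans_apply, LinearEquiv.trans_apply, LinearEquiv.apply_symm_apply]
  have := congrArg (fun φ : Module.Dual K ℓ' => φ x') key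
  simpa [LinearEquiv.dualMap_apply] using this

/-- the identity in the form `B (a x, d y) = B (x, y)` (`x ∈ ℓ`, `y ∈ m`). [cite: Rangarao1993, §2.1 Lemma 2.1 (iv)] -/
theorem apply_apply_extendDual (hN : B.Nondegenerate) (hm : B.orthogonal m = m) (hℓ : B.orthogonal ℓ = ℓ)
    (h : IsCompl ℓ m) (hm' : B.orthogonal m' = m') (hℓ' : B.orthogonal ℓ' = ℓ') (h' : IsCompl ℓ' m')
    (a : ℓ ≃ₗ[K] ℓ') (x : ℓ) (y : m) :
    B (a x : ℓ') (extendDual hN hm hℓ h hm' hℓ' h' a y) = B x y := by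
  rw [apply_extendDual, LinearEquiv.symm_apply_apply]

/-- **the extension `g = a ⊕ (a*)⁻¹` of `a : ℓ ≃ ℓ'` to `V = ℓ ⊕ m → ℓ' ⊕ m' = V`**.
[cite: Rangarao1993, §2.1 Lemma 2.1 (iv)] -/
noncomputable def extendSp (hN : B.Nondegenerate) (hm : B.orthogonal m = m) (hℓ : B.orthogonal ℓ = ℓ)
    (h : IsCompl ℓ m) (hm' : B.orthogonal m' = m') (hℓ' : B.orthogonal ℓ' = ℓ') (h' : IsCompl ℓ' m')
    (a : ℓ ≃ₗ[K] ℓ') : V ≃ₗ[K] V :=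
  ((Submodule.prodEquivOfIsCompl ℓ m h).symm.trans
    (a.prodCongr (extendDual hN hm hℓ h hm' hℓ' h' a))).trans (Submodule.prodEquivOfIsCompl ℓ' m' h')

/-- value on `x + y` (`x ∈ ℓ`, `y ∈ m`): `a x + d y`. [cite: Rangarao1993, §2.1 Lemma 2.1 (iv)] -/
theorem extendSp_apply_add (hN : B.Nondegenerate) (hm : B.orthogonal m = m) (hℓ : B.orthogonal ℓ = ℓ)
    (h : IsCompl ℓ m) (hm' : B.orthogonal m' = m') (hℓ' : B.orthogonal ℓ' = ℓ') (h' : IsCompl ℓ' m')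
    (a : ℓ ≃ₗ[K] ℓ') (x : ℓ) (y : m) :
    extendSp hN hm hℓ h hm' hℓ' h' a ((x : V) + y) =
      (a x : V) + (extendDual hN hm hℓ h hm' hℓ' h' a y : V) := by
  have hxy : (Submodule.prodEquivOfIsCompl ℓ m h).symm ((x : V) + y) = (x, y) := by
    rw [LinearEquiv.symm_apply_eq, Submodule.coe_prodEquivOfIsCompl']
  simp only [extendSp, LinearEquiv.trans_apply, hxy, LinearEquiv.prodCongr_apply,
    Submodule.coe_prodEquivOfIsCompl']

/-- value on `ℓ`: `g x = a x`. [cite: Rangarao1993, §2.1 Lemma 2.1 (iv)] -/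
theorem extendSp_apply_left (hN : B.Nondegenerate) (hm : B.orthogonal m = m) (hℓ : B.orthogonal ℓ = ℓ)
    (h : IsCompl ℓ m) (hm' : B.orthogonal m' = m') (hℓ' : B.orthogonal ℓ' = ℓ') (h' : IsCompl ℓ' m')
    (a : ℓ ≃ₗ[K] ℓ') (x : ℓ) :
    extendSp hN hm hℓ h hm' hℓ' h' a x = a x := by
  have := extendSp_apply_add hN hm hℓ h hm' hℓ' h' a x 0
  simpa using this

/-- value on `m`: `g y = d y`. [cite: Rangarao1993, §2.1 Lemma 2.1 (iv)] -/
theorem extendSp_apply_right (hN : B.Nondegenerate) (hm : B.orthogonal m = m) (hℓ : B.orthogonal ℓ = ℓ)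
    (h : IsCompl ℓ m) (hm' : B.orthogonal m' = m') (hℓ' : B.orthogonal ℓ' = ℓ') (h' : IsCompl ℓ' m')
    (a : ℓ ≃ₗ[K] ℓ') (y : m) :
    extendSp hN hm hℓ h hm' hℓ' h' a y = extendDual hN hm hℓ h hm' hℓ' h' a y := by
  have := extendSp_apply_add hN hm hℓ h hm' hℓ' h' a 0 y
  simpa using this

/-- **`g` is an isometry of `B`** (`B` alternating): on `(x₁ + y₁, x₂ + y₂)` both sides are
`B(x₁, y₂) + B(y₁, x₂)`, using `B(a x, d y) = B(x, y)`, `B(d y, a x) = -B(a x, d y)` and the isotropy of the four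
planes. [cite: Rangarao1993, §2.1 Lemma 2.1 (iv)] -/
theorem extendSp_mem_isometries (hN : B.Nondegenerate) (hm : B.orthogonal m = m) (hℓ : B.orthogonal ℓ = ℓ)
    (h : IsCompl ℓ m) (hm' : B.orthogonal m' = m') (hℓ' : B.orthogonal ℓ' = ℓ') (h' : IsCompl ℓ' m')
    (a : ℓ ≃ₗ[K] ℓ') (hB : LinearMap.IsAlt B) :
    extendSp hN hm hℓ h hm' hℓ' h' a ∈ Heisenberg.PseudoSymplectic.isometries B := by
  rw [Heisenberg.PseudoSymplectic.mem_isometries]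
  intro v w
  obtain ⟨x₁, hx₁, y₁, hy₁, rfl⟩ := Submodule.mem_sup.1 (show v ∈ ℓ ⊔ m by rw [h.sup_eq_top]; trivial)
  obtain ⟨x₂, hx₂, y₂, hy₂, rfl⟩ := Submodule.mem_sup.1 (show w ∈ ℓ ⊔ m by rw [h.sup_eq_top]; trivial)
  have e₁ := extendSp_apply_add hN hm hℓ h hm' hℓ' h' a ⟨x₁, hx₁⟩ ⟨y₁, hy₁⟩
  have e₂ := extendSp_apply_add hN hm hℓ h hm' hℓ' h' a ⟨x₂, hx₂⟩ ⟨y₂, hy₂⟩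
  rw [e₁, e₂]
  have i₁ := isotropic_of_orthogonal_eq_self hℓ' _ (a ⟨x₁, hx₁⟩).2 _ (a ⟨x₂, hx₂⟩).2
  have i₂ := isotropic_of_orthogonal_eq_self hm' _ (extendDual hN hm hℓ h hm' hℓ' h' a ⟨y₁, hy₁⟩).2 _
    (extendDual hN hm hℓ h hm' hℓ' h' a ⟨y₂, hy₂⟩).2
  have i₃ := isotropic_of_orthogonal_eq_self hℓ _ hx₁ _ hx₂
  have i₄ := isotropic_of_orthogonal_eq_self hm _ hy₁ _ hy₂
  have k₁ := apply_apply_extendDual hN hm hℓ h hm' hℓ' h' a ⟨x₁, hx₁⟩ ⟨y₂, hy₂⟩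
  have k₂ := apply_apply_extendDual hN hm hℓ h hm' hℓ' h' a ⟨x₂, hx₂⟩ ⟨y₁, hy₁⟩
  have n₁ := hB.neg (extendDual hN hm hℓ h hm' hℓ' h' a ⟨y₁, hy₁⟩ : V) (a ⟨x₂, hx₂⟩ : V)
  have n₂ := hB.neg y₁ x₂
  simp only [map_add, LinearMap.add_apply]
  linear_combination i₁ + i₂ - i₃ - i₄ + k₁ - n₁ - k₂ + n₂

/-- `g ℓ = ℓ'`. [cite: Rangarao1993, §2.1 Lemma 2.1 (iv)] -/
theorem map_extendSp_left (hN : B.Nondegenerate) (hm : B.orthogonal m = m) (hℓ : B.orthogonal ℓ = ℓ)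
    (h : IsCompl ℓ m) (hm' : B.orthogonal m' = m') (hℓ' : B.orthogonal ℓ' = ℓ') (h' : IsCompl ℓ' m')
    (a : ℓ ≃ₗ[K] ℓ') :
    ℓ.map (extendSp hN hm hℓ h hm' hℓ' h' a : V →ₗ[K] V) = ℓ' := by
  ext z
  constructor
  · rintro ⟨x, hx, rfl⟩
    rw [LinearEquiv.coe_coe, show x = ((⟨x, hx⟩ : ℓ) : V) from rfl, extendSp_apply_left]
    exact (a ⟨x, hx⟩).2
  · intro hz
    refine ⟨(a.symm ⟨z, hz⟩ : ℓ), (a.symm ⟨z, hz⟩).2, ?_⟩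
    rw [LinearEquiv.coe_coe, extendSp_apply_left, LinearEquiv.apply_symm_apply]

/-- `g m = m'`. [cite: Rangarao1993, §2.1 Lemma 2.1 (iv)] -/
theorem map_extendSp_right (hN : B.Nondegenerate) (hm : B.orthogonal m = m) (hℓ : B.orthogonal ℓ = ℓ)
    (h : IsCompl ℓ m) (hm' : B.orthogonal m' = m') (hℓ' : B.orthogonal ℓ' = ℓ') (h' : IsCompl ℓ' m')
    (a : ℓ ≃ₗ[K] ℓ') :
    m.map (extendSp hN hm hℓ h hm' hℓ' h' a : V →ₗ[K] V) = m' := by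
  ext z
  constructor
  · rintro ⟨y, hy, rfl⟩
    rw [LinearEquiv.coe_coe, show y = ((⟨y, hy⟩ : m) : V) from rfl, extendSp_apply_right]
    exact (extendDual hN hm hℓ h hm' hℓ' h' a ⟨y, hy⟩).2
  · intro hz
    refine ⟨((extendDual hN hm hℓ h hm' hℓ' h' a).symm ⟨z, hz⟩ : m),
      ((extendDual hN hm hℓ h hm' hℓ' h' a).symm ⟨z, hz⟩).2, ?_⟩
    rw [LinearEquiv.coe_coe, extendSp_apply_right, LinearEquiv.apply_symm_apply]

end Extend

/-! ## §3 `Sp(X)` acts transitively on `Λ(X)` -/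

section Transitive

variable [FiniteDimensional K V] {B : LinearMap.BilinForm K V}

/-- **Lemma 2.1 (iv), same-space form**: transversal Lagrangian pairs `(ℓ, m)`, `(ℓ', m')` and a linear
isomorphism `a : ℓ ≃ ℓ'` give an isometry `g` of `B` with `g|_ℓ = a`, `gℓ = ℓ'`, `gm = m'`.
[cite: Rangarao1993, §2.1 Lemma 2.1 (iv)] -/
theorem exists_isometry_extending (hB : LinearMap.IsAlt B) (hN : B.Nondegenerate) {ℓ m ℓ' m' : Submodule K V}
    (hℓ : B.orthogonal ℓ = ℓ) (hm : B.orthogonal m = m) (h : IsCompl ℓ m) (hℓ' : B.orthogonal ℓ' = ℓ')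
    (hm' : B.orthogonal m' = m') (h' : IsCompl ℓ' m') (a : ℓ ≃ₗ[K] ℓ') :
    ∃ g ∈ Heisenberg.PseudoSymplectic.isometries B, (∀ x : ℓ, g x = (a x : V)) ∧
      ℓ.map (g : V →ₗ[K] V) = ℓ' ∧ m.map (g : V →ₗ[K] V) = m' :=
  ⟨extendSp hN hm hℓ h hm' hℓ' h' a, extendSp_mem_isometries hN hm hℓ h hm' hℓ' h' a hB,
    extendSp_apply_left hN hm hℓ h hm' hℓ' h' a, map_extendSp_left hN hm hℓ h hm' hℓ' h' a,
    map_extendSp_right hN hm hℓ h hm' hℓ' h' a⟩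

/-- **transitivity on transversal pairs**: `Sp(B)` carries any transversal Lagrangian pair to any other.
[cite: Rangarao1993, §2.1 Lemma 2.1 (iv), §2.2 Lemma 2.3] -/
theorem exists_isometry_map_pair_eq (hB : LinearMap.IsAlt B) (hN : B.Nondegenerate) {ℓ m ℓ' m' : Submodule K V}
    (hℓ : B.orthogonal ℓ = ℓ) (hm : B.orthogonal m = m) (h : IsCompl ℓ m) (hℓ' : B.orthogonal ℓ' = ℓ')
    (hm' : B.orthogonal m' = m') (h' : IsCompl ℓ' m') :
    ∃ g ∈ Heisenberg.PseudoSymplectic.isometries B,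
      ℓ.map (g : V →ₗ[K] V) = ℓ' ∧ m.map (g : V →ₗ[K] V) = m' := by
  obtain ⟨g, hg, -, h₁, h₂⟩ := exists_isometry_extending hB hN hℓ hm h hℓ' hm' h'
    (LinearEquiv.ofFinrankEq ℓ ℓ' (finrank_eq_of_orthogonal_eq_self hN hℓ hℓ'))
  exact ⟨g, hg, h₁, h₂⟩

/-- **"`Sp(X)` acts transitively on `Λ(X)`"**: for any two Lagrangians `ℓ, ℓ'` of the symplectic space `(V, B)`
(`B` alternating nondegenerate, any field) there is `g ∈ Sp(B)` with `gℓ = ℓ'` — via transversal complements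
([Duistermaat2011, Thm. 3.4.2]) and Lemma 2.1 (iv). [cite: Rangarao1993, §2.2 p. 338] -/
theorem exists_isometry_map_eq (hB : LinearMap.IsAlt B) (hN : B.Nondegenerate) {ℓ ℓ' : Submodule K V}
    (hℓ : B.orthogonal ℓ = ℓ) (hℓ' : B.orthogonal ℓ' = ℓ') :
    ∃ g ∈ Heisenberg.PseudoSymplectic.isometries B, ℓ.map (g : V →ₗ[K] V) = ℓ' := by
  obtain ⟨m, hm, h⟩ := exists_orthogonal_eq_self_isCompl hB hN hℓ
  obtain ⟨m', hm', h'⟩ := exists_orthogonal_eq_self_isCompl hB hN hℓ'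
  obtain ⟨g, hg, h₁, -⟩ := exists_isometry_map_pair_eq hB hN hℓ hm h hℓ' hm' h'
  exact ⟨g, hg, h₁⟩

/-- the same with `g` a member of the subgroup `Sp(B)`. [cite: Rangarao1993, §2.2 p. 338] -/
theorem exists_isometries_map_eq (hB : LinearMap.IsAlt B) (hN : B.Nondegenerate) {ℓ ℓ' : Submodule K V}
    (hℓ : B.orthogonal ℓ = ℓ) (hℓ' : B.orthogonal ℓ' = ℓ') :
    ∃ g : Heisenberg.PseudoSymplectic.isometries B, ℓ.map ((g : V ≃ₗ[K] V) : V →ₗ[K] V) = ℓ' := by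
  obtain ⟨g, hg, h⟩ := exists_isometry_map_eq hB hN hℓ hℓ'
  exact ⟨⟨g, hg⟩, h⟩

end Transitive

/-! ## §4 The big cell `Ω_ℓ = {g ∈ Sp(B) | gℓ ⋔ ℓ}` and its genericity -/

section BigCell

variable (B : LinearMap.BilinForm K V) (ℓ : Submodule K V)

/-- images of submodules compose: `(g h)ℓ = g(hℓ)`. [cite: Rangarao1993, §2.2 p. 338] -/
theorem map_mul (g h : V ≃ₗ[K] V) :
    ℓ.map ((g * h : V ≃ₗ[K] V) : V →ₗ[K] V) = (ℓ.map (h : V →ₗ[K] V)).map (g : V →ₗ[K] V) := by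
  rw [LinearEquiv.coe_toLinearMap_mul, Module.End.mul_eq_comp, Submodule.map_comp]

/-- a linear automorphism preserves transversality of a pair of subspaces. [cite: Rangarao1993, §2.2 p. 338] -/
theorem isCompl_map {p₁ p₂ : Submodule K V} (g : V ≃ₗ[K] V) (h : IsCompl p₁ p₂) :
    IsCompl (p₁.map (g : V →ₗ[K] V)) (p₂.map (g : V →ₗ[K] V)) :=
  (Submodule.orderIsoMapComap g).isCompl h

/-- … and reflects it. [cite: Rangarao1993, §2.2 p. 338] -/
theorem isCompl_map_iff {p₁ p₂ : Submodule K V} (g : V ≃ₗ[K] V) :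
    IsCompl (p₁.map (g : V →ₗ[K] V)) (p₂.map (g : V →ₗ[K] V)) ↔ IsCompl p₁ p₂ :=
  ((Submodule.orderIsoMapComap g).isCompl_iff).symm

/-- **the big cell relative to `ℓ`**: the isometries `g` with `gℓ` transversal to `ℓ` — Weil's `Ω(X)` ("`γ(s)` est
un isomorphisme de `X*` sur `X`", for `ℓ = X*`), Rao's open double coset `Ω_n = P τ P`.
[cite: Weil1964, n° 32; Rangarao1993, §2.2 p. 338] -/
def bigCell : Set (Heisenberg.PseudoSymplectic.isometries B) :=
  {g | IsCompl (ℓ.map ((g : V ≃ₗ[K] V) : V →ₗ[K] V)) ℓ}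

variable {B ℓ}

/-- membership. [cite: Weil1964, n° 32] -/
theorem mem_bigCell_iff (g : Heisenberg.PseudoSymplectic.isometries B) :
    g ∈ bigCell B ℓ ↔ IsCompl (ℓ.map ((g : V ≃ₗ[K] V) : V →ₗ[K] V)) ℓ := Iff.rfl

/-- `1 ∉ Ω_ℓ` as soon as `ℓ ≠ 0` (`ℓ` is not transversal to itself). [cite: Weil1964, n° 32] -/
theorem one_notMem_bigCell (hℓ : ℓ ≠ ⊥) : (1 : Heisenberg.PseudoSymplectic.isometries B) ∉ bigCell B ℓ := by
  intro h
  rw [mem_bigCell_iff, Subgroup.coe_one, LinearEquiv.coe_toLinearMap_one, Submodule.map_id] at h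
  exact hℓ (by simpa using h.disjoint.eq_bot)

/-- `Ω_ℓ⁻¹ = Ω_ℓ`: `gℓ ⋔ ℓ ↔ ℓ ⋔ g⁻¹ℓ` (apply `g⁻¹`). [cite: Weil1964, n° 32] -/
theorem inv_mem_bigCell_iff (g : Heisenberg.PseudoSymplectic.isometries B) : g⁻¹ ∈ bigCell B ℓ ↔ g ∈ bigCell B ℓ := by
  rw [mem_bigCell_iff, mem_bigCell_iff, ← isCompl_map_iff (g : V ≃ₗ[K] V) (p₁ := ℓ.map _) (p₂ := ℓ),
    ← map_mul, Subgroup.coe_inv, mul_inv_cancel, LinearEquiv.coe_toLinearMap_one, Submodule.map_id]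
  exact isCompl_comm

/-- left translation by the stabiliser `P_ℓ` preserves `Ω_ℓ`: `pℓ = ℓ ⇒ (p g ∈ Ω_ℓ ↔ g ∈ Ω_ℓ)`.
[cite: Rangarao1993, §2.2 p. 338 (P_L); Weil1964, n° 32] -/
theorem mul_mem_bigCell_iff_of_map_eq {p : Heisenberg.PseudoSymplectic.isometries B}
    (hp : ℓ.map ((p : V ≃ₗ[K] V) : V →ₗ[K] V) = ℓ) (g : Heisenberg.PseudoSymplectic.isometries B) :
    p * g ∈ bigCell B ℓ ↔ g ∈ bigCell B ℓ := by
  rw [mem_bigCell_iff, mem_bigCell_iff, Subgroup.coe_mul, map_mul,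
    ← isCompl_map_iff (p : V ≃ₗ[K] V) (p₁ := ℓ.map _) (p₂ := ℓ), hp]

/-- right translation by the stabiliser `P_ℓ` preserves `Ω_ℓ`: `pℓ = ℓ ⇒ (g p ∈ Ω_ℓ ↔ g ∈ Ω_ℓ)`.
[cite: Rangarao1993, §2.2 p. 338 (P_L); Weil1964, n° 32] -/
theorem mul_mem_bigCell_iff_of_map_eq_right {p : Heisenberg.PseudoSymplectic.isometries B}
    (hp : ℓ.map ((p : V ≃ₗ[K] V) : V →ₗ[K] V) = ℓ) (g : Heisenberg.PseudoSymplectic.isometries B) :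
    g * p ∈ bigCell B ℓ ↔ g ∈ bigCell B ℓ := by
  rw [mem_bigCell_iff, mem_bigCell_iff, Subgroup.coe_mul, map_mul, hp]

/-- an isometric image of a Lagrangian is a Lagrangian. [cite: LionVergne1980, §1.1.3–1.1.4] -/
theorem orthogonal_map_eq_self_of_mem [FiniteDimensional K V] (hN : B.Nondegenerate) (hℓ : B.orthogonal ℓ = ℓ)
    (g : Heisenberg.PseudoSymplectic.isometries B) :
    B.orthogonal (ℓ.map ((g : V ≃ₗ[K] V) : V →ₗ[K] V)) = ℓ.map ((g : V ≃ₗ[K] V) : V →ₗ[K] V) := by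
  have hg : ∀ x y, B ((g : V ≃ₗ[K] V) x) ((g : V ≃ₗ[K] V) y) = B x y :=
    (Heisenberg.PseudoSymplectic.mem_isometries B (g : V ≃ₗ[K] V)).1 g.2
  refine orthogonal_eq_self_of_isotropic hN ?_ ?_
  · intro x hx y hy
    obtain ⟨a, ha, rfl⟩ := Submodule.mem_map.1 hx
    obtain ⟨b, hb, rfl⟩ := Submodule.mem_map.1 hy
    rw [LinearEquiv.coe_coe, hg]
    exact isotropic_of_orthogonal_eq_self hℓ a ha b hb
  · rw [LinearEquiv.finrank_map_eq]
    exact two_mul_finrank_eq_of_orthogonal_eq_self hN hℓ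

/-- **the big cell is left-generic (infinite field)** — the hypothesis of Weil's Lemme 6 for `U = Ω(X)`
([Weil1964, n° 42]: "il en sera ainsi … quand on prend `G = Ps(X)`, `U = Ω(X)`"): for every finite
`T ⊆ Sp(B)` there is `x ∈ Sp(B)` with `x t ∈ Ω_ℓ` for all `t ∈ T`.  Proof: take a Lagrangian `m` transversal to every
`tℓ` ([LionVergne1980, §1.5.8]) and `x` with `x m = ℓ` (transitivity); then `(x t)ℓ = x(tℓ) ⋔ x m = ℓ`.
[cite: Weil1964, n° 42 (after Lemme 6), p. 196] -/
theorem isLeftGeneric_bigCell [Infinite K] [FiniteDimensional K V] (hB : LinearMap.IsAlt B) (hN : B.Nondegenerate)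
    (hℓ : B.orthogonal ℓ = ℓ) : IsLeftGeneric (bigCell B ℓ) := by
  intro T
  -- the Lagrangians `tℓ`, `t ∈ T`
  obtain ⟨m, hm, hc⟩ := exists_orthogonal_eq_self_isCompl_forall (ι := {t // t ∈ T}) hB hN
    (fun t => ℓ.map (((t.1 : Heisenberg.PseudoSymplectic.isometries B) : V ≃ₗ[K] V) : V →ₗ[K] V))
    (fun t => orthogonal_map_eq_self_of_mem hN hℓ _)
  obtain ⟨x, hx⟩ := exists_isometries_map_eq hB hN hm hℓ
  refine ⟨x, fun t ht => ?_⟩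
  rw [mem_bigCell_iff, Subgroup.coe_mul, map_mul]
  conv => arg 2; rw [← hx]
  exact isCompl_map (x : V ≃ₗ[K] V) (hc ⟨t, ht⟩)

/-- consequently every `g ∈ Sp(B)` is a quotient of two big-cell elements (`Sp = Ω⁻¹ Ω = Ω Ω`).
[cite: Weil1964, n° 42 Lemme 6 ("`G` est engendré par les éléments de `U`"), p. 195] -/
theorem exists_eq_inv_mul_of_bigCell [Infinite K] [FiniteDimensional K V] (hB : LinearMap.IsAlt B)
    (hN : B.Nondegenerate) (hℓ : B.orthogonal ℓ = ℓ) (g : Heisenberg.PseudoSymplectic.isometries B) :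
    ∃ x ∈ bigCell B ℓ, ∃ y ∈ bigCell B ℓ, g = x⁻¹ * y :=
  (isLeftGeneric_bigCell hB hN hℓ).exists_eq_inv_mul g

end BigCell

end Literature.LinearAlgebra.QuadraticForm
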